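import Summits.ValiantsHypothesis.ValiantsHypothesis.Theses.ShallowShadows
import Literature.Computability.AlgebraicComplexity.PermanentCompleteness
import Literature.Computability.Complexity.KWProtocol
import Literature.Computability.Complexity.KWProtocolBounds
import Summits.ValiantsHypothesis.ValiantsHypothesis.Theorems.ShallowShadowsShadowFormulaTransferStubKwFormula
import Summits.ValiantsHypothesis.ValiantsHypothesis.Theorems.ShallowShadowsShadowFormulaTransferDetProtocolRegimes
import Summits.ValiantsHypothesis.ValiantsHypothesis.Theorems.ShallowShadowsShadowFormulaTransferShadowOfArithExpr
import Summits.ValiantsHypothesis.ValiantsHypothesis.Theorems.ShallowShadowsShadowFormulaTransferShadowMulDominated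
import Summits.ValiantsHypothesis.ValiantsHypothesis.Theorems.ShallowShadowsShadowFormulaTransferShadowOfSos
import Summits.ValiantsHypothesis.ValiantsHypothesis.Theorems.ShallowShadowsShadowFormulaTransferKWOrAnd

/-!
# Crux `ShadowFormulaTransfer` (stmt-ValiantsHypothesis-17124) — line `Sketch-ideator1`
# (POSITIVITY CERTIFICATES), lead c1's registered skeleton

The crux X (route `ShallowShadows`): `∃ δ > 0, ∃ C, ∀ 0/1-coefficient VP_ℂ families f, eventually
in n, L_mon-formula(B f_n) ≤ 2 ^ (deg(f_n)^{1-δ} (log(n+2))^C + C)`, where the SHADOW of a polynomial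
`g` is the monotone Boolean function `B g : a ↦ [∃ monomial of g with support ⊆ a]`.

THE LINE (cards `Ideas/positive-multiples.md`, `Ideas/positivity-certificates.md`, ideator
`planner-cruxidea-…-1-0`, sketch `Sketch-ideator1.lean`). Jukna's lattice reading `+ ↦ ∨, × ↦ ∧` of
an arithmetic computation is EXACT for the shadow whenever no summand carries a PHANTOM support,
and two kinds of POSITIVITY kill phantoms:
(M) computations over the semiring `ℝ≥0` (no cancellation at all): a monotone arithmetic FORMULA
    `φ` of size `L` for ANY nonnegative multiple `f·Q` whose cofactor is shadow-dominated
    (`B f ≤ B Q`, e.g. `Q(0) > 0`) is, gate by gate, a monotone Boolean formula of size `≤ L` for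
    `B(f·Q) = B f` (Jukna arXiv:1406.3065 Lemma 7 + the domination rule);
(S) sums of POINTWISE-NONNEGATIVE terms: if `f(x²)·q(x)² = Σ_{i<T} c_i (Π_{j<k} G_ij)²` with
    `c_i > 0`, a shadow-dominated denominator `q` and SIGNED real polynomials `G_ij` of degree
    `≤ A`, then `B f = ∨_i ∧_j B(G_ij)` exactly (a nonnegative summand of a pointwise-zero sum
    vanishes pointwise, hence as a polynomial over the infinite field `ℝ`; `B(f q²) = B f` over a
    domain), a monotone formula of depth `log T + log k + A log N + log N`.
The `0/1` hypothesis is what makes both certificates EXIST (`f ≥ 0` coefficientwise: `Q = 1` with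
the trivial formula; `f(x²) = Σ_m (x^m)²`); for the refuter's `{0,±1}` witness `det` neither exists
(`det(x²)` is not PSD; no nonnegative `Q` makes `det·Q` monotone). VP-ness must bound the LENGTH:
for `per` every certificate of either kind is long (`2^{Ω(m)}`, modulo Raz–Wigderson). So both
hypotheses the disprover proved load-bearing (`Disproof.lean` §1: X is false in characteristic 2;
`Negative/FalseWithoutZeroOne`) have a job, and the line is a positivity argument by construction.

THE STUBS (5 registered; 1 open):
* `stub_positivityCertificate` — THE LINE'S BET (conjecture-grade, OPEN, held by the lead):
  every `0/1` VP_ℂ family admits, eventually in `n`, a certificate of kind (M) of size within the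
  crux's budget `2^{deg^{1-δ}(log(n+2))^C + C}`, OR a certificate of kind (S) (with denominator)
  with `⌈log₂ T⌉ + ⌈log₂ k⌉ + A ⌈log₂(N+1)⌉ + ⌈log₂ N⌉` within the budget's exponent. STRONGER
  than X.
* `stub_shadowOfArithExpr` — Jukna's Lemma 7 in the tree's models (`ArithExpr ℝ≥0 ι`, BCS (21.19);
  `formulaSizeOver monotoneBasis`): provable now, size M.
* `stub_shadowMulDominated` — `B(p·Q) = B p` for `B p ≤ B Q` over `ℝ≥0`: provable now, size S.
* `stub_shadowOfSos` — phantom-freeness of (S): provable now, size M (`MvPolynomial.funext`).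
* `stub_kwOrAnd` — the `∨_{i<T} ∧_{j<k}` combination of monotone KW protocols (Alice names `i`,
  Bob names `j`): depth `⌈log₂ T⌉ + ⌈log₂ k⌉ + D`: provable now, size S.
* `ShadowFormulaTransfer_of : Registered.stub_positivityCertificate → ShadowFormulaTransfer` — the
  composition, PROVED here sorry-free (the four transfer stubs, all LANDED in wave 1 of cycle 1,
  are discharged inside; plus the shadow of the characteristic lift, the width protocol
  `exists_kwTree_shadow_width` and KW `stub_kwFormula` landed by line det-kw, real bookkeeping).
  STATE after cycle 1: ONE sorry = the open bet.

References: Jukna arXiv:1406.3065 Lemma 7; CFM arXiv:2512.19515 Obs. 1.3 / Thm 1.4; Valiant 1980;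
Karchmer–Wigderson 1990 §2; Raz–Wigderson 1992 (far side); BCS 1997 (21.19) (`ArithExpr`).
-/

-- Sub = Summit single-conjunct layout: the duplicated namespace component is mandated by the tree.
set_option linter.dupNamespace false

noncomputable section

namespace Summit.ValiantsHypothesis.ValiantsHypothesis.Cruxes.ShadowFormulaTransfer.Positivity

open Summit.ValiantsHypothesis.ValiantsHypothesis.Theses.ShallowShadows
open Literature.Computability.AlgebraicComplexity Literature.Computability.Complexity
open scoped NNReal

/-! ## The stub statements, named -/

/-- **POSITIVITY CERTIFICATES** (stub statement, named; the line's bet, conjecture-grade): every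
`0/1`-coefficient VP_ℂ family has, eventually in `n`, EITHER (M) a monotone arithmetic formula
`φ` over `ℝ≥0` computing a shadow-dominated nonnegative multiple `lift(f_n)·Q` of the
characteristic lift `lift(f_n) = Σ_{m ∈ supp f_n} x^m`, of size within the crux's budget, OR (S) an
identity `lift(f_n)(x²) · q(x)² = Σ_{i<T} c_i (Π_{j<k} G_ij)²` with `c_i > 0`, a shadow-dominated
denominator `q` (`B f_n ≤ B q`; Hilbert's 17th problem WITH denominators), SIGNED real `G_ij` with
`deg G_ij ≤ A`, and `⌈log₂ T⌉ + ⌈log₂ k⌉ + A ⌈log₂(#σ n + 1)⌉ + ⌈log₂ #σ n⌉` within the budget's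
exponent. (RESHAPE 1, lead c1, cycle 1: the denominator `q` was added — `q = 1` is the card's
`SosOfProducts`; strictly weaker obligation, same composition.)
[conjecture-grade: arXiv:1406.3065 L7, arXiv:2512.19515 Thm 1.4 (monotone side);
RazWigderson1992 (far side); Valiant1980] -/
def PositivityCertificate : Prop :=
  ∃ δ : ℝ, 0 < δ ∧ ∃ C : ℕ, ∀ (σ : ℕ → Type) [∀ n, Fintype (σ n)] [∀ n, DecidableEq (σ n)]
    (f : ∀ n, MvPolynomial (σ n) ℂ), IsVPFamily f →
    (∀ (n : ℕ) (m : σ n →₀ ℕ), (f n).coeff m = 0 ∨ (f n).coeff m = 1) →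
    ∃ n₀ : ℕ, ∀ n ≥ n₀,
      (∃ (Q : MvPolynomial (σ n) ℝ≥0) (φ : ArithExpr ℝ≥0 (σ n)),
        (∀ a : σ n → Bool, (∃ m ∈ (f n).support, ∀ i ∈ m.support, a i = true) →
          ∃ m ∈ Q.support, ∀ i ∈ m.support, a i = true) ∧
        φ.eval = (∑ m ∈ (f n).support, MvPolynomial.monomial m (1 : ℝ≥0)) * Q ∧
        (φ.size : ℝ) ≤ 2 ^ (((f n).totalDegree : ℝ) ^ (1 - δ) * (Real.log (n + 2)) ^ C + C)) ∨
      (∃ (T k A : ℕ) (c : Fin T → ℝ) (q : MvPolynomial (σ n) ℝ)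
          (G : Fin T → Fin k → MvPolynomial (σ n) ℝ),
        (∀ i, 0 < c i) ∧ (∀ i j, (G i j).totalDegree ≤ A) ∧
        (∀ a : σ n → Bool, (∃ m ∈ (f n).support, ∀ i ∈ m.support, a i = true) →
          ∃ m ∈ q.support, ∀ i ∈ m.support, a i = true) ∧
        MvPolynomial.expand 2 (∑ m ∈ (f n).support, MvPolynomial.monomial m (1 : ℝ)) * q ^ 2 =
          ∑ i, MvPolynomial.C (c i) * (∏ j, G i j) ^ 2 ∧
        ((Nat.clog 2 T + Nat.clog 2 k + A * Nat.clog 2 (Fintype.card (σ n) + 1) +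
            Nat.clog 2 (Fintype.card (σ n)) : ℕ) : ℝ) ≤
          ((f n).totalDegree : ℝ) ^ (1 - δ) * (Real.log (n + 2)) ^ C + C)

/-- **JUKNA'S LEMMA 7, formula form** (stub statement, named): a monotone arithmetic formula `φ`
over the semiring `ℝ≥0` (tree: `ArithExpr`, BCS (21.19)) yields a monotone Boolean formula for
the shadow of the polynomial it computes with at most `φ.size` gates (`+ ↦ ∨₂`, `× ↦ ∧₂`,
constants and zero subformulas simplified away; a constant shadow has the junk value `0`).
[known, to be formalised: arXiv:1406.3065 Lemma 7; arXiv:2512.19515 Obs. 1.3] -/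
def ShadowOfArithExpr : Prop :=
  ∀ (ι : Type) [Fintype ι] (φ : ArithExpr ℝ≥0 ι),
    formulaSizeOver monotoneBasis
        (fun a : ι → Bool => decide (∃ m ∈ φ.eval.support, ∀ i ∈ m.support, a i = true)) ≤
      φ.size

/-- **SHADOW OF A DOMINATED PRODUCT** (stub statement, named): over `ℝ≥0` (no cancellation, no
zero divisors) `B(p·Q) = B p ∧ B Q`, hence `= B p` when `B p ≤ B Q`. [folklore] -/
def ShadowMulDominated : Prop :=
  ∀ (ι : Type) (p Q : MvPolynomial ι ℝ≥0),
    (∀ a : ι → Bool, (∃ m ∈ p.support, ∀ i ∈ m.support, a i = true) →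
      ∃ m ∈ Q.support, ∀ i ∈ m.support, a i = true) →
    ∀ a : ι → Bool, (∃ m ∈ (p * Q).support, ∀ i ∈ m.support, a i = true) ↔
      ∃ m ∈ p.support, ∀ i ∈ m.support, a i = true

/-- **PHANTOM-FREENESS OF SUMS OF SQUARES** (stub statement, named): if `p(x²) = Σ_i c_i (Π_j G_ij)²`
over `ℝ` with all `c_i > 0`, then `B p = ∨_i ∧_j B(G_ij)` exactly — restriction to a face is a
ring map, a positive combination of squares vanishing at every real point has every square
vanishing at every real point, hence vanishing as a polynomial (`MvPolynomial.funext`), and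
`B(p(x²)) = B p`, `B(G²) = B G`, `B(Π G_j) = ∧ B(G_j)` over a domain. [folklore] -/
def ShadowOfSos : Prop :=
  ∀ (ι : Type) (T k : ℕ) (c : Fin T → ℝ) (G : Fin T → Fin k → MvPolynomial ι ℝ)
    (p : MvPolynomial ι ℝ), (∀ i, 0 < c i) →
    MvPolynomial.expand 2 p = ∑ i, MvPolynomial.C (c i) * (∏ j, G i j) ^ 2 →
    ∀ a : ι → Bool, (∃ m ∈ p.support, ∀ i ∈ m.support, a i = true) ↔
      ∃ i : Fin T, ∀ j : Fin k, ∃ m ∈ (G i j).support, ∀ l ∈ m.support, a l = true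

/-- **∨∧ OF PROTOCOLS** (stub statement, named): if every `h i j` (`i < T`, `j < k`) has a monotone
KW protocol of depth `≤ D`, then `a ↦ ∨_i ∧_j h i j a` has one of depth
`≤ ⌈log₂ T⌉ + ⌈log₂ k⌉ + D` (Alice names an `i` all of whose `h i j` accept `a`, Bob names a `j`
with `h i j b = 0`, then they run the protocol of `h i j`). [cite: KarchmerWigderson1990, §2] -/
def KWOrAnd : Prop :=
  ∀ (ι : Type) [Nonempty ι] (T k D : ℕ) (h : Fin T → Fin k → (ι → Bool) → Bool),
    (∀ i j, ∃ P : KWTree ι, P.SolvesMono (h i j) ∧ P.depth ≤ D) →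
    ∃ P : KWTree ι, P.SolvesMono (fun a : ι → Bool => decide (∃ i, ∀ j, h i j a = true)) ∧
      P.depth ≤ Nat.clog 2 T + Nat.clog 2 k + D

/-! ## The stubs (registered obligations; signatures = the named statements verbatim) -/

/-- Stub PositivityCertificate — OPEN, the line's bet (held by the lead).
[conjecture-grade: arXiv:1406.3065, arXiv:2512.19515, RazWigderson1992, Valiant1980] -/
theorem stub_positivityCertificate :
    ∃ δ : ℝ, 0 < δ ∧ ∃ C : ℕ, ∀ (σ : ℕ → Type) [∀ n, Fintype (σ n)] [∀ n, DecidableEq (σ n)]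
      (f : ∀ n, MvPolynomial (σ n) ℂ), IsVPFamily f →
      (∀ (n : ℕ) (m : σ n →₀ ℕ), (f n).coeff m = 0 ∨ (f n).coeff m = 1) →
      ∃ n₀ : ℕ, ∀ n ≥ n₀,
        (∃ (Q : MvPolynomial (σ n) ℝ≥0) (φ : ArithExpr ℝ≥0 (σ n)),
          (∀ a : σ n → Bool, (∃ m ∈ (f n).support, ∀ i ∈ m.support, a i = true) →
            ∃ m ∈ Q.support, ∀ i ∈ m.support, a i = true) ∧
          φ.eval = (∑ m ∈ (f n).support, MvPolynomial.monomial m (1 : ℝ≥0)) * Q ∧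
          (φ.size : ℝ) ≤ 2 ^ (((f n).totalDegree : ℝ) ^ (1 - δ) * (Real.log (n + 2)) ^ C + C)) ∨
        (∃ (T k A : ℕ) (c : Fin T → ℝ) (q : MvPolynomial (σ n) ℝ)
            (G : Fin T → Fin k → MvPolynomial (σ n) ℝ),
          (∀ i, 0 < c i) ∧ (∀ i j, (G i j).totalDegree ≤ A) ∧
          (∀ a : σ n → Bool, (∃ m ∈ (f n).support, ∀ i ∈ m.support, a i = true) →
            ∃ m ∈ q.support, ∀ i ∈ m.support, a i = true) ∧
          MvPolynomial.expand 2 (∑ m ∈ (f n).support, MvPolynomial.monomial m (1 : ℝ)) * q ^ 2 =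
            ∑ i, MvPolynomial.C (c i) * (∏ j, G i j) ^ 2 ∧
          ((Nat.clog 2 T + Nat.clog 2 k + A * Nat.clog 2 (Fintype.card (σ n) + 1) +
              Nat.clog 2 (Fintype.card (σ n)) : ℕ) : ℝ) ≤
            ((f n).totalDegree : ℝ) ^ (1 - δ) * (Real.log (n + 2)) ^ C + C) := by
  sorry

/-- Stub ShadowOfArithExpr (Jukna's Lemma 7, formula form). LANDED (worker, wave 1):
`Theorems/ShallowShadowsShadowFormulaTransferShadowOfArithExpr.lean` (p162237).
[cite: arXiv:1406.3065, Lemma 7] [folklore] -/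
theorem stub_shadowOfArithExpr :
    ∀ (ι : Type) [Fintype ι] (φ : ArithExpr ℝ≥0 ι),
      formulaSizeOver monotoneBasis
          (fun a : ι → Bool => decide (∃ m ∈ φ.eval.support, ∀ i ∈ m.support, a i = true)) ≤
        φ.size := by
  intro ι _ φ
  have h := _root_.Summit.ValiantsHypothesis.ValiantsHypothesis.Theorems.ShallowShadowsShadowFormulaTransfer.stub_shadowOfArithExpr ι φ
  -- bridge the `Decidable` spellings of the shadow through the proposition
  have key : ∀ (B₁ B₀ : (ι → Bool) → Bool), (∀ a, B₁ a = B₀ a) →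
      formulaSizeOver monotoneBasis B₁ ≤ φ.size → formulaSizeOver monotoneBasis B₀ ≤ φ.size := by
    intro B₁ B₀ hB h
    have hBB : B₁ = B₀ := funext hB
    subst hBB
    exact h
  exact key _ _ (fun a => decide_eq_decide.mpr Iff.rfl) h

/-- Stub ShadowMulDominated. LANDED (worker, wave 1):
`Theorems/ShallowShadowsShadowFormulaTransferShadowMulDominated.lean` (p162512). [folklore] -/
theorem stub_shadowMulDominated :
    ∀ (ι : Type) (p Q : MvPolynomial ι ℝ≥0),
      (∀ a : ι → Bool, (∃ m ∈ p.support, ∀ i ∈ m.support, a i = true) →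
        ∃ m ∈ Q.support, ∀ i ∈ m.support, a i = true) →
      ∀ a : ι → Bool, (∃ m ∈ (p * Q).support, ∀ i ∈ m.support, a i = true) ↔
        ∃ m ∈ p.support, ∀ i ∈ m.support, a i = true :=
  _root_.Summit.ValiantsHypothesis.ValiantsHypothesis.Theorems.ShallowShadowsShadowFormulaTransfer.stub_shadowMulDominated

/-- Stub ShadowOfSos (phantom-freeness). LANDED (worker, wave 1):
`Theorems/ShallowShadowsShadowFormulaTransferShadowOfSos.lean` (p162801). [folklore] -/
theorem stub_shadowOfSos :
    ∀ (ι : Type) (T k : ℕ) (c : Fin T → ℝ) (G : Fin T → Fin k → MvPolynomial ι ℝ)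
      (p : MvPolynomial ι ℝ), (∀ i, 0 < c i) →
      MvPolynomial.expand 2 p = ∑ i, MvPolynomial.C (c i) * (∏ j, G i j) ^ 2 →
      ∀ a : ι → Bool, (∃ m ∈ p.support, ∀ i ∈ m.support, a i = true) ↔
        ∃ i : Fin T, ∀ j : Fin k, ∃ m ∈ (G i j).support, ∀ l ∈ m.support, a l = true :=
  _root_.Summit.ValiantsHypothesis.ValiantsHypothesis.Theorems.ShallowShadowsShadowFormulaTransfer.stub_shadowOfSos

/-- Stub KWOrAnd. LANDED (worker, wave 1):
`Theorems/ShallowShadowsShadowFormulaTransferKWOrAnd.lean` (p162845). [cite: KarchmerWigderson1990, §2] -/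
theorem stub_kwOrAnd :
    ∀ (ι : Type) [Nonempty ι] (T k D : ℕ) (h : Fin T → Fin k → (ι → Bool) → Bool),
      (∀ i j, ∃ P : KWTree ι, P.SolvesMono (h i j) ∧ P.depth ≤ D) →
      ∃ P : KWTree ι, P.SolvesMono (fun a : ι → Bool => decide (∃ i, ∀ j, h i j a = true)) ∧
        P.depth ≤ Nat.clog 2 T + Nat.clog 2 k + D := by
  intro ι _ T k D h htrees
  choose P hP hD using htrees
  exact _root_.Summit.ValiantsHypothesis.ValiantsHypothesis.Theorems.ShallowShadowsShadowFormulaTransfer.exists_kwTree_or_and h P hP hD _ fun a => decide_eq_true_iff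

/-! ## Name-keyed aliases of the stub statements (hypotheses of the composition) -/
namespace Registered

/-- Alias of `PositivityCertificate` (= the signature of `stub_positivityCertificate`). -/
abbrev stub_positivityCertificate : Prop := PositivityCertificate
/-- Alias of `ShadowOfArithExpr` (= the signature of `stub_shadowOfArithExpr`). -/
abbrev stub_shadowOfArithExpr : Prop := ShadowOfArithExpr
/-- Alias of `ShadowMulDominated` (= the signature of `stub_shadowMulDominated`). -/
abbrev stub_shadowMulDominated : Prop := ShadowMulDominated
/-- Alias of `ShadowOfSos` (= the signature of `stub_shadowOfSos`). -/
abbrev stub_shadowOfSos : Prop := ShadowOfSos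
/-- Alias of `KWOrAnd` (= the signature of `stub_kwOrAnd`). -/
abbrev stub_kwOrAnd : Prop := KWOrAnd

end Registered

/-! ## Proved glue -/

/-- Over an EMPTY variable set there is no circuit over the monotone basis `{∧₂, ∨₂}` at all, so
`formulaSizeOver` is its junk value `0`. (Adapted verbatim from line det-kw's skeleton,
`Lines/det_kw.lean`, lead 0.) [folklore] -/
theorem formulaSizeOver_monotoneBasis_of_isEmpty {ι : Type} [IsEmpty ι]
    (h : (ι → Bool) → Bool) : formulaSizeOver monotoneBasis h = 0 := by
  unfold formulaSizeOver
  convert Nat.sInf_empty using 2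
  ext s
  simp only [Set.mem_setOf_eq, Set.mem_empty_iff_false, iff_false, not_exists, not_and]
  intro C hB _ _ _
  exfalso
  have harity : ∀ g ∈ C.gates, g.arity = 2 := by
    intro g hg
    have hfn := hB g hg
    simp only [monotoneBasis, Set.mem_insert_iff, Set.mem_singleton_iff, Gate.fn, GateFn.and,
      GateFn.or] at hfn
    rcases hfn with h1 | h1 <;> exact congrArg Sigma.fst h1
  cases hout : C.output with
  | inl i => exact IsEmpty.false i
  | inr m =>
    have hm : m < C.gates.length := C.wf_output m hout
    have hlen : 0 < C.gates.length := by omega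
    have hg0 : C.gates[0] ∈ C.gates := List.getElem_mem hlen
    have ha : (C.gates[0]).arity = 2 := harity _ hg0
    set g := C.gates[0] with hg
    have hpos : 0 < g.arity := by omega
    cases harg : g.args ⟨0, hpos⟩ with
    | inl i => exact IsEmpty.false i
    | inr m' =>
      have := C.wf 0 hlen ⟨0, hpos⟩ m' harg
      omega

/-- The characteristic lift `Σ_{m ∈ supp g} x^m` of `g` over a nontrivial semiring `R` has the
same support as `g`. [folklore] -/
theorem support_lift {ι : Type} {S : Type*} [CommSemiring S] (g : MvPolynomial ι S)
    (R : Type*) [CommSemiring R] [Nontrivial R] :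
    (∑ m ∈ g.support, MvPolynomial.monomial m (1 : R)).support = g.support := by
  classical
  ext m
  rw [MvPolynomial.mem_support_iff, MvPolynomial.coeff_sum]
  simp only [MvPolynomial.coeff_monomial]
  rw [Finset.sum_ite_eq']
  split_ifs with hm
  · simp [hm]
  · simp [hm]

/-- Hence the lift has the same shadow. [folklore] -/
theorem shadow_lift_iff {ι : Type} {S : Type*} [CommSemiring S] (g : MvPolynomial ι S)
    (R : Type*) [CommSemiring R] [Nontrivial R] (a : ι → Bool) :
    (∃ m ∈ (∑ m ∈ g.support, MvPolynomial.monomial m (1 : R)).support,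
        ∀ i ∈ m.support, a i = true) ↔
      ∃ m ∈ g.support, ∀ i ∈ m.support, a i = true := by
  rw [support_lift]

/-- **Phantom-freeness with a denominator** (glue; the `q = 1` case is the landed stub
`stub_shadowOfSos`, whose proof this follows on top of its landed helpers): if
`p(x²) · q² = Σ_i c_i (Π_j G_ij)²` over `ℝ` with `c_i > 0` and `B p ≤ B q`, then
`B p = ∨_i ∧_j B(G_ij)`. [folklore] -/
theorem shadow_of_sos_denominator {ι : Type} (T k : ℕ) (c : Fin T → ℝ)
    (G : Fin T → Fin k → MvPolynomial ι ℝ) (p q : MvPolynomial ι ℝ) (hc : ∀ i, 0 < c i)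
    (hdom : ∀ a : ι → Bool, (∃ m ∈ p.support, ∀ i ∈ m.support, a i = true) →
      ∃ m ∈ q.support, ∀ i ∈ m.support, a i = true)
    (hp : MvPolynomial.expand 2 p * q ^ 2 = ∑ i, MvPolynomial.C (c i) * (∏ j, G i j) ^ 2)
    (a : ι → Bool) :
    (∃ m ∈ p.support, ∀ i ∈ m.support, a i = true) ↔
      ∃ i : Fin T, ∀ j : Fin k, ∃ m ∈ (G i j).support, ∀ l ∈ m.support, a l = true := by
  open MvPolynomial in
  open _root_.Summit.ValiantsHypothesis.ValiantsHypothesis.Theorems.ShallowShadowsShadowFormulaTransfer in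
  have key : (∃ m ∈ p.support, ∀ i ∈ m.support, a i = true) ↔
      bind₁ (fun l => if a l then (X l : MvPolynomial ι ℝ) else 0) (expand 2 p * q ^ 2) ≠ 0 := by
    rw [map_mul, map_pow, mul_ne_zero_iff, pow_ne_zero_iff two_ne_zero,
      ← shadow_iff_restrictFace_ne_zero, ← shadow_iff_restrictFace_ne_zero, shadow_expand_two_iff]
    exact ⟨fun h => ⟨h, hdom a h⟩, fun h => h.1⟩
  rw [key, hp]
  simp only [map_sum, map_mul, map_pow, map_prod, bind₁_C_right]
  rw [sum_ne_zero_iff_of_eval_nonneg Finset.univ _ fun i _ x => by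
    rw [map_mul, eval_C, map_pow]
    exact mul_nonneg (hc i).le (sq_nonneg _)]
  simp only [Finset.mem_univ, true_and, ne_eq, mul_eq_zero, C_eq_zero, (hc _).ne', false_or,
    pow_eq_zero_iff two_ne_zero, Finset.prod_eq_zero_iff, not_exists,
    shadow_iff_restrictFace_ne_zero]

/-- `(N+1)^e ≤ 2^(A ⌈log₂(N+1)⌉)` for `e ≤ A`. [folklore] -/
theorem pow_le_two_pow_of_le {N e A : ℕ} (he : e ≤ A) :
    (N + 1) ^ e ≤ 2 ^ (A * Nat.clog 2 (N + 1)) :=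
  (Nat.pow_le_pow_right (Nat.succ_pos N) he).trans
    (Summit.ValiantsHypothesis.ValiantsHypothesis.Theorems.ShallowShadowsShadowFormulaTransfer.pow_le_two_pow_mul_clog
      N A)

/-- Cast of a natural power of two into a real `rpow`, monotone in the exponent bound. [folklore] -/
theorem natCast_two_pow_le_rpow {e : ℕ} {x : ℝ} (h : (e : ℝ) ≤ x) :
    ((2 ^ e : ℕ) : ℝ) ≤ (2 : ℝ) ^ x := by
  have : ((2 ^ e : ℕ) : ℝ) = (2 : ℝ) ^ (e : ℝ) := by
    rw [Real.rpow_natCast]; push_cast; ring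
  rw [this]
  exact Real.rpow_le_rpow_of_exponent_le (by norm_num) h

/-! ## The composition -/

/-- **Composition** (the glue of the line, kernel-checked; after wave 1 of cycle 1 its only
hypothesis is the open bet, the four transfer stubs being tree theorems): a certificate of kind (M) gives
`L(B f_n) = L(B(lift f_n · Q)) = L(B φ.eval) ≤ φ.size ≤ budget` by the domination rule and
Jukna's Lemma 7; a certificate of kind (S) gives `B f_n = ∨_i ∧_j B(G_ij)` (phantom-freeness),
each `B(G_ij)` has the width protocol of depth `A ⌈log₂(N+1)⌉ + ⌈log₂ N⌉` (tree), the `∨∧`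
combination adds `⌈log₂ T⌉ + ⌈log₂ k⌉`, and KW turns depth into formula size `2^depth ≤ 2^budget`.
Empty variable sets contribute the junk value `0`. Constants: the certificate's own `δ, C`.
[folklore] -/
theorem ShadowFormulaTransfer_of :
    Registered.stub_positivityCertificate → ShadowFormulaTransfer := by
  intro hC
  -- the four LANDED transfer stubs are discharged here (tree theorems, wired through the stub
  -- declarations above); only the open bet remains a hypothesis
  have hL7 : Registered.stub_shadowOfArithExpr := stub_shadowOfArithExpr
  have hG4 : Registered.stub_shadowMulDominated := stub_shadowMulDominated
  have hOA : Registered.stub_kwOrAnd := stub_kwOrAnd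
  obtain ⟨δ, hδ, C₀, hcert⟩ := hC
  refine ⟨δ, hδ, C₀, ?_⟩
  intro σ _ _ f hVP h01
  obtain ⟨n₀, hn₀⟩ := hcert σ f hVP h01
  refine ⟨n₀, fun n hn => ?_⟩
  -- the budget and its positivity
  set W : ℝ := ((f n).totalDegree : ℝ) ^ (1 - δ) * (Real.log (n + 2)) ^ C₀ + C₀ with hW
  have hpow_nonneg : (0 : ℝ) ≤ (2 : ℝ) ^ W := Real.rpow_nonneg (by norm_num) W
  -- empty variable sets: junk value 0
  by_cases hne : Nonempty (σ n)
  swap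
  · have hem : IsEmpty (σ n) := not_nonempty_iff.mp hne
    rw [formulaSizeOver_monotoneBasis_of_isEmpty]
    push_cast
    exact hpow_nonneg
  rcases hn₀ n hn with ⟨Q, φ, hdom, heval, hsize⟩ | ⟨T, k, A, c, q, G, hc, hdeg, hdomq, hexp, hbudget⟩
  · /- kind (M): monotone formula for a dominated multiple -/
    have hdom' : ∀ a : σ n → Bool,
        (∃ m ∈ (∑ m ∈ (f n).support, MvPolynomial.monomial m (1 : ℝ≥0)).support,
          ∀ i ∈ m.support, a i = true) → ∃ m ∈ Q.support, ∀ i ∈ m.support, a i = true :=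
      fun a ha => hdom a ((shadow_lift_iff (f n) ℝ≥0 a).mp ha)
    have hmul := hG4 (σ n) _ Q hdom'
    -- the shadow of `φ.eval` is the shadow of `f n`, pointwise as propositions
    have hiffM : ∀ a : σ n → Bool, (∃ m ∈ φ.eval.support, ∀ i ∈ m.support, a i = true) ↔
        ∃ m ∈ (f n).support, ∀ i ∈ m.support, a i = true := by
      intro a
      rw [heval]
      exact (hmul a).trans (shadow_lift_iff (f n) ℝ≥0 a)
    have h7 := hL7 (σ n) φ
    -- compare spellings of the shadow through the propositions (Decidable instances may differ)
    have key : ∀ (B₁ B₀ : (σ n → Bool) → Bool), (∀ a, B₁ a = B₀ a) →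
        formulaSizeOver monotoneBasis B₁ ≤ φ.size →
        (formulaSizeOver monotoneBasis B₀ : ℝ) ≤ (2 : ℝ) ^ W := by
      intro B₁ B₀ hB h
      have hBB : B₁ = B₀ := funext hB
      subst hBB
      have hR : (formulaSizeOver monotoneBasis B₁ : ℝ) ≤ φ.size := by exact_mod_cast h
      exact hR.trans hsize
    exact key _ _ (fun a => decide_eq_decide.mpr (hiffM a)) h7
  · /- kind (S): sum of positive multiples of squares of products, with a denominator
       (the landed `q = 1` stub `stub_shadowOfSos` is subsumed by the glue
       `shadow_of_sos_denominator`, proved from its landed helpers) -/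
    set N := Fintype.card (σ n) with hN
    -- width protocols for the factors
    have htrees : ∀ i j, ∃ P : KWTree (σ n),
        P.SolvesMono (fun a : σ n → Bool =>
          decide (∃ m ∈ (G i j).support, ∀ l ∈ m.support, a l = true)) ∧
        P.depth ≤ A * Nat.clog 2 (N + 1) + Nat.clog 2 N := by
      intro i j
      obtain ⟨P, hsol, hdepth⟩ :=
        Summit.ValiantsHypothesis.ValiantsHypothesis.Theorems.ShallowShadowsShadowFormulaTransfer.exists_kwTree_shadow_width
          (G i j) (A * Nat.clog 2 (N + 1)) (Nat.clog 2 N)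
          (pow_le_two_pow_of_le (hdeg i j)) (Nat.le_pow_clog (by norm_num) _)
      exact ⟨P, fun a b ha hb => hsol a b (by simpa using ha) (by simpa using hb), hdepth⟩
    obtain ⟨P, hsol, hdepth⟩ := hOA (σ n) T k (A * Nat.clog 2 (N + 1) + Nat.clog 2 N)
      (fun i j a => decide (∃ m ∈ (G i j).support, ∀ l ∈ m.support, a l = true)) htrees
    -- the shadow of `f n` is the ∨∧ of the factor shadows
    have hiff : ∀ a : σ n → Bool, (∃ m ∈ (f n).support, ∀ i ∈ m.support, a i = true) ↔
        ∃ i : Fin T, ∀ j : Fin k, ∃ m ∈ (G i j).support, ∀ l ∈ m.support, a l = true := by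
      intro a
      rw [← shadow_lift_iff (f n) ℝ a]
      refine shadow_of_sos_denominator T k c G _ q hc (fun a' ha' => hdomq a' ?_) hexp a
      exact (shadow_lift_iff (f n) ℝ a').mp ha'
    have hsol' : P.SolvesMono
        (fun a : σ n → Bool => decide (∃ m ∈ (f n).support, ∀ i ∈ m.support, a i = true)) := by
      intro a b ha hb
      refine hsol a b ?_ ?_
      · rw [decide_eq_true_iff] at ha ⊢
        obtain ⟨i, hi⟩ := (hiff a).mp ha
        exact ⟨i, fun j => decide_eq_true_iff.mpr (hi j)⟩
      · rw [decide_eq_false_iff_not] at hb ⊢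
        rintro ⟨i, hi⟩
        exact hb ((hiff b).mpr ⟨i, fun j => decide_eq_true_iff.mp (hi j)⟩)
    have hsize :=
      Summit.ValiantsHypothesis.ValiantsHypothesis.Theorems.ShallowShadowsShadowFormulaTransfer.stub_kwFormula
        (σ n) _ P hsol'
    have hexpo : ((P.depth : ℕ) : ℝ) ≤ W := by
      have h1 : (P.depth : ℝ) ≤ ((Nat.clog 2 T + Nat.clog 2 k + (A * Nat.clog 2 (N + 1) +
          Nat.clog 2 N) : ℕ) : ℝ) := by exact_mod_cast hdepth
      refine h1.trans ?_
      have h2 : ((Nat.clog 2 T + Nat.clog 2 k + (A * Nat.clog 2 (N + 1) + Nat.clog 2 N) : ℕ) : ℝ) =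
          ((Nat.clog 2 T + Nat.clog 2 k + A * Nat.clog 2 (N + 1) + Nat.clog 2 N : ℕ) : ℝ) := by
        push_cast; ring
      rw [h2]
      exact hbudget
    have hchain : (formulaSizeOver monotoneBasis
        (fun a : σ n → Bool => decide (∃ m ∈ (f n).support, ∀ i ∈ m.support, a i = true)) : ℝ) ≤
        (2 : ℝ) ^ W := by
      have h3 : (formulaSizeOver monotoneBasis
          (fun a : σ n → Bool => decide (∃ m ∈ (f n).support, ∀ i ∈ m.support, a i = true)) : ℝ) ≤
          ((2 ^ P.depth : ℕ) : ℝ) := by exact_mod_cast hsize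
      exact h3.trans (natCast_two_pow_le_rpow hexpo)
    have e : ∀ {x y : ℝ}, x = y → y ≤ (2 : ℝ) ^ W → x ≤ (2 : ℝ) ^ W := fun h1 h2 => h1 ▸ h2
    refine e ?_ hchain
    exact congrArg (fun B : (σ n → Bool) → Bool => (formulaSizeOver monotoneBasis B : ℝ))
      (funext fun a => decide_eq_decide.mpr Iff.rfl)

/-- Wiring check: after wave 1 the skeleton is `ShadowFormulaTransfer` closed modulo the ONE
remaining stub `stub_positivityCertificate` (the only `sorry` in this file; the four transfer stubs
are tree theorems wired through the stub decls above). -/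
example : ShadowFormulaTransfer :=
  ShadowFormulaTransfer_of stub_positivityCertificate

end Summit.ValiantsHypothesis.ValiantsHypothesis.Cruxes.ShadowFormulaTransfer.Positivity

end
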